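import Summits.SmoothPoincare4.SmoothPoincare4.Theses.SymplecticOrigami
import Summits.SmoothPoincare4.SmoothPoincare4.Theorems.SymplecticOrigamiOrigamiRungStubPinchPieceHomeomorph
import Literature.Geometry.Symplectic.CodimTwoComplementConnected
import Literature.Topology.FourManifolds.RegularLevelSet

/-!
# Stub `stub_foldGysin` of line `pair-rigidity-endgame` (crux `SymplecticOrigami.OrigamiRung`),
# part I: the fold fibration has connected fibres

A `--supports` helper for the registered stub `stub_foldGysin`.  Setting: a compact `4`-manifold
`M` is split by the regular level `Z = f⁻¹(0) = frontier V`; the blow-down `β` of the open piece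
`V` is continuous near `closure V`, maps `V` homeomorphically onto the complement `N ∖ B` of the
compact surface `B = b(S)` (`b` a smooth embedding; landed `stub_pinch_pieceHomeomorph`) and folds
`Z` onto `B`; `φ : Z → S` is the lift, `b ∘ φ = β ∘ incl`.  **Claim: every fibre `φ⁻¹(y)` is
preconnected** (`stub_foldGysin_fibres`).

Proof (point-set topology plus one differential-topological input).

* `exists_mem_nhds_subset_isPreconnected_inter_compl_range` — **small coordinate balls minus a
  codimension-`2` image are preconnected**: every neighbourhood `D` of a point of the
  `p`-manifold `N` contains a neighbourhood `D'` with `D' ∖ b(S)` preconnected when `b` is `C^∞`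
  on a compact `m`-manifold and `m + 2 ≤ p` (a ball minus a set with thin line cones; the tree's
  `exists_mem_nhds_isPreconnected_inter_compl_range`, Kosinski X.1, with the ball shrunk into `D`).
* `isPreconnected_frontier_inter_preimage_singleton` — **the topological heart.**  Let
  `K = Z ∩ β⁻¹(y)` (compact).  If `K` split into two disjoint nonempty closed parts, separate
  them by disjoint open sets `O₁`, `O₂` (compact Hausdorff); by compactness of
  `closure V ∖ (O₁ ∪ O₂)` there is a neighbourhood `D` of `y` with
  `closure V ∩ β⁻¹(D) ⊆ O₁ ∪ O₂` (a point of `closure V` over `y` lies in `Z`, as `β(V) = Bᶜ ∌ y`,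
  hence in `K`); shrink to `D'` with `D' ∖ B` preconnected; then `A = V ∩ β⁻¹(D')` is
  preconnected (preimage under the homeomorphism `V ≅ Bᶜ`), lies in `O₁ ∪ O₂`, and meets both
  (each point of `K ⊆ Z = frontier V` is adherent to `V`, and `β` is continuous there) —
  impossible.
* `stub_foldGysin_fibres` — transport along the embedding `incl : Z → M`:
  `incl (φ⁻¹(y)) = Z ∩ β⁻¹(b y)` because `b` is injective.
-/

noncomputable section

-- the prescribed namespace `Summit.<P>.<Sub>.…` duplicates `SmoothPoincare4` (P = Sub)
set_option linter.dupNamespace false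

open scoped Manifold ContDiff Topology ContinuousMap
open Set TopologicalSpace Filter
open Literature.Topology.FourManifolds (IsRegularLevel RegularLevel)

namespace Summit.SmoothPoincare4.SmoothPoincare4.Theorems.OrigamiRung.PairRigidityEndgame

section CodimTwo

open Literature.Geometry.Symplectic Module

variable {m p : ℕ} {N : Type*} [TopologicalSpace N] [ChartedSpace (EuclideanSpace ℝ (Fin p)) N]
  [IsManifold (𝓡 p) ∞ N]
  {S : Type*} [TopologicalSpace S] [CompactSpace S] [ChartedSpace (EuclideanSpace ℝ (Fin m)) S]
  [IsManifold (𝓡 m) ∞ S] {b : S → N}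

/-- **Small coordinate balls minus `b(S)` are preconnected.** If `m + 2 ≤ p` and `b : S → N` is
`C^∞` on a compact `m`-manifold, then every neighbourhood `D` of a point `q` of the `p`-manifold
`N` contains a neighbourhood `D'` of `q` (the preimage of a small coordinate ball) with
`D' ∩ (range b)ᶜ` preconnected: in the chart this is a ball minus a set whose line cones have
Hausdorff dimension `≤ m + 1 < p` (`isPreconnected_diff_of_dimH_lineCone_lt`,
`dimH_lineCone_extChartAt_image_range_le`).  Kosinski, *Differential Manifolds* (1993), X.1,
proof of Prop. 1.1. [folklore] -/
theorem exists_mem_nhds_subset_isPreconnected_inter_compl_range (hmp : m + 2 ≤ p)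
    (hb : ContMDiff (𝓡 m) (𝓡 p) ∞ b) (q : N) {D : Set N} (hD : D ∈ 𝓝 q) :
    ∃ D' ∈ 𝓝 q, D' ⊆ D ∧ IsPreconnected (D' ∩ (range b)ᶜ) := by
  -- adapted from `Literature.Geometry.Symplectic.exists_mem_nhds_isPreconnected_inter_compl_range`
  -- (the coordinate ball is shrunk into the prescribed neighbourhood `D`)
  set e := extChartAt (𝓡 p) q
  have hn : e.target ∩ e.symm ⁻¹' D ∈ 𝓝 (e q) :=
    inter_mem (extChartAt_target_mem_nhds q) (extChartAt_preimage_mem_nhds hD)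
  obtain ⟨r, hr, hball⟩ : ∃ r > 0, Metric.ball (e q) r ⊆ e.target ∩ e.symm ⁻¹' D :=
    Metric.mem_nhds_iff.1 hn
  set Dr := Metric.ball (e q) r
  set T := e '' (range b ∩ e.source)
  refine ⟨e.source ∩ e ⁻¹' Dr, ?_, ?_, ?_⟩
  · refine ((continuousOn_extChartAt q).isOpen_inter_preimage (isOpen_extChartAt_source q)
      Metric.isOpen_ball).mem_nhds ⟨mem_extChartAt_source q, ?_⟩
    exact Metric.mem_ball_self hr
  · rintro z ⟨hzs, hzD⟩
    have hz : e z ∈ e.symm ⁻¹' D := (hball hzD).2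
    rw [mem_preimage, e.left_inv hzs] at hz
    exact hz
  · have hpre : IsPreconnected (Dr \ T) :=
      isPreconnected_diff_of_dimH_lineCone_lt (convex_ball _ _) Metric.isOpen_ball fun x =>
        (dimH_lineCone_extChartAt_image_range_le hb q x).trans_lt (by
          rw [finrank_euclideanSpace_fin]; exact_mod_cast (by omega : m + 1 < p))
    have heq : e.source ∩ e ⁻¹' Dr ∩ (range b)ᶜ = e.symm '' (Dr \ T) := by
      ext z
      constructor
      · rintro ⟨⟨hzs, hzD⟩, hzB⟩
        refine ⟨e z, ⟨hzD, ?_⟩, e.left_inv hzs⟩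
        rintro ⟨w, ⟨hwB, hws⟩, hw⟩
        apply hzB
        have : w = z := by rw [← e.left_inv hws, ← e.left_inv hzs, hw]
        exact this ▸ hwB
      · rintro ⟨y, ⟨hyD, hyT⟩, rfl⟩
        have hyt : y ∈ e.target := (hball hyD).1
        refine ⟨⟨e.map_target hyt, ?_⟩, fun hB => hyT ⟨e.symm y, ⟨hB, e.map_target hyt⟩,
          e.right_inv hyt⟩⟩
        show e (e.symm y) ∈ Dr
        rw [e.right_inv hyt]
        exact hyD
    rw [heq]
    exact hpre.image _
      ((continuousOn_extChartAt_symm q).mono (sdiff_subset.trans fun y hy => (hball hy).1))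

end CodimTwo

section Topological

variable {M N : Type*} [TopologicalSpace M] [CompactSpace M] [T2Space M] [TopologicalSpace N]
  [T2Space N] {V U : Set M} {B : Set N} {β : M → N}

/-- **The fibres of the fold under a blow-down are preconnected (topological form).**  Let `M`
be compact Hausdorff, `V ⊆ M` with `closure V ⊆ U`, `U` open, `β : M → N` continuous on `U`
(`N` Hausdorff), mapping `V` homeomorphically onto `Bᶜ` (`e`) and `frontier V` into `B`, and
suppose every neighbourhood of `y` contains a neighbourhood `D'` of `y` with `D' ∩ Bᶜ`
preconnected.  Then `frontier V ∩ β⁻¹(y)` is preconnected.  If it split into nonempty disjoint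
closed parts inside disjoint opens `O₁`, `O₂`, compactness of `closure V ∖ (O₁ ∪ O₂)` gives a
neighbourhood `D` of `y` with `closure V ∩ β⁻¹(D) ⊆ O₁ ∪ O₂`; for `D' ⊆ D` as above the
preconnected set `V ∩ β⁻¹(D') ⊆ O₁ ∪ O₂` meets both `Oᵢ` (its points accumulate at every point
of `frontier V` over `y`) — a contradiction. [folklore] -/
theorem isPreconnected_frontier_inter_preimage_singleton (hU : IsOpen U) (hVU : closure V ⊆ U)
    (hβ : ContinuousOn β U) (hβV : β '' V = Bᶜ) (hβfr : β '' frontier V ⊆ B)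
    (e : ↥V ≃ₜ ↥Bᶜ) (he : ∀ x, (e x : N) = β x) {y : N}
    (hloc : ∀ D ∈ 𝓝 y, ∃ D' ∈ 𝓝 y, D' ⊆ D ∧ IsPreconnected (D' ∩ Bᶜ)) :
    IsPreconnected (frontier V ∩ β ⁻¹' {y}) := by
  set K := frontier V ∩ β ⁻¹' {y} with hK
  have hKcl : IsClosed K := by
    have h1 : IsClosed (closure V ∩ β ⁻¹' {y}) :=
      (hβ.mono hVU).preimage_isClosed_of_isClosed isClosed_closure isClosed_singleton
    have h2 : K = frontier V ∩ (closure V ∩ β ⁻¹' {y}) := by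
      rw [← inter_assoc, inter_eq_left.2 frontier_subset_closure]
    rw [h2]
    exact isClosed_frontier.inter h1
  rw [isPreconnected_iff_subset_of_fully_disjoint_closed hKcl]
  intro u v hu hv hKuv huv
  by_contra hcon
  obtain ⟨h1, h2⟩ := not_or.1 hcon
  obtain ⟨x₂, hx₂K, hx₂u⟩ := not_subset.1 h1
  obtain ⟨x₁, hx₁K, hx₁v⟩ := not_subset.1 h2
  have hx₁u : x₁ ∈ u := (hKuv hx₁K).resolve_right hx₁v
  have hx₂v : x₂ ∈ v := (hKuv hx₂K).resolve_left hx₂u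
  -- `y ∈ B`, as the fibre is nonempty
  have hyB : y ∈ B := hβfr ⟨x₁, hx₁K.1, hx₁K.2⟩
  -- separate the two parts by disjoint open sets
  obtain ⟨O₁, O₂, hO₁, hO₂, huO₁, hvO₂, hO⟩ :=
    SeparatedNhds.of_isCompact_isCompact hu.isCompact hv.isCompact huv
  -- a neighbourhood `D` of `y` with `closure V ∩ β ⁻¹' D ⊆ O₁ ∪ O₂`
  set C := closure V \ (O₁ ∪ O₂) with hC
  have hCc : IsCompact C := (isClosed_closure.sdiff (hO₁.union hO₂)).isCompact
  have hβC : IsCompact (β '' C) := hCc.image_of_continuousOn (hβ.mono (sdiff_subset.trans hVU))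
  have hyC : y ∉ β '' C := by
    rintro ⟨x, ⟨hxcl, hxO⟩, hxy⟩
    rw [closure_eq_self_union_frontier] at hxcl
    rcases hxcl with hxV | hxfr
    · have hxB : β x ∈ Bᶜ := hβV ▸ mem_image_of_mem β hxV
      exact hxB (hxy ▸ hyB)
    · have hxK : x ∈ K := ⟨hxfr, hxy⟩
      exact hxO ((hKuv hxK).elim (fun h => Or.inl (huO₁ h)) fun h => Or.inr (hvO₂ h))
  have hD : (β '' C)ᶜ ∈ 𝓝 y := hβC.isClosed.isOpen_compl.mem_nhds hyC
  obtain ⟨D', hD', hD'D, hpre⟩ := hloc _ hD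
  -- `A := V ∩ β ⁻¹' D'` is preconnected, being the preimage of `D' ∩ Bᶜ` under `V ≅ Bᶜ`
  set A := V ∩ β ⁻¹' D' with hA_def
  have hA : IsPreconnected A := by
    have h3 : IsPreconnected ((Subtype.val : ↥Bᶜ → N) ⁻¹' D') := by
      rw [← Topology.IsInducing.subtypeVal.isPreconnected_image, Subtype.image_preimage_coe,
        inter_comm]
      exact hpre
    have h4 : IsPreconnected (e ⁻¹' ((Subtype.val : ↥Bᶜ → N) ⁻¹' D')) :=
      e.isPreconnected_preimage.2 h3
    have h5 := h4.image _ continuous_subtype_val.continuousOn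
    have hAeq : A = Subtype.val '' (e ⁻¹' ((Subtype.val : ↥Bᶜ → N) ⁻¹' D')) := by
      ext x
      constructor
      · rintro ⟨hxV, hxD'⟩
        refine ⟨⟨x, hxV⟩, ?_, rfl⟩
        show (e ⟨x, hxV⟩ : N) ∈ D'
        rw [he]
        exact hxD'
      · rintro ⟨z, hz, rfl⟩
        have hz' : (e z : N) ∈ D' := hz
        rw [he] at hz'
        exact ⟨z.2, hz'⟩
    rw [hAeq]
    exact h5
  have hAsub : A ⊆ O₁ ∪ O₂ := by
    rintro x ⟨hxV, hxD'⟩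
    by_contra hxO
    exact hD'D hxD' ⟨x, ⟨subset_closure hxV, hxO⟩, rfl⟩
  -- `A` meets every open set through a point of the fibre
  have hmeet : ∀ {x : M} {O : Set M}, x ∈ K → IsOpen O → x ∈ O → (A ∩ O).Nonempty := by
    intro x O hxK hO hxO
    have hxU : U ∈ 𝓝 x := hU.mem_nhds (hVU (frontier_subset_closure hxK.1))
    have hβx : ContinuousAt β x := hβ.continuousAt hxU
    have hxy : β x = y := hxK.2
    have hn : β ⁻¹' D' ∩ O ∈ 𝓝 x :=
      inter_mem (hβx.preimage_mem_nhds (by rw [hxy]; exact hD')) (hO.mem_nhds hxO)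
    obtain ⟨z, hzn, hzV⟩ := mem_closure_iff_nhds.1 (frontier_subset_closure hxK.1) _ hn
    exact ⟨z, ⟨hzV, hzn.1⟩, hzn.2⟩
  obtain ⟨z, -, hz⟩ := hA O₁ O₂ hO₁ hO₂ hAsub (hmeet hx₁K hO₁ (huO₁ hx₁u))
    (hmeet hx₂K hO₂ (hvO₂ hx₂v))
  exact Set.disjoint_iff.1 hO hz

end Topological

/-! ### The helper for the stub -/

/-- **The fold fibration has preconnected fibres** (helper for `stub_foldGysin`).  For one piece
`V` of the fold of the compact `4`-manifold `M` with blow-down `β : M → N` (smooth near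
`closure V`, injective with bijective differential on `V`, `β '' V = (range b)ᶜ`,
`β '' frontier V ⊆ range b` for the smooth embedding `b : S → N` of a compact surface) and the
lift `φ : Z → S` of `β` on the fold `Z = f⁻¹(0) = frontier V` (`b ∘ φ = β ∘ incl`), every fibre
`φ⁻¹(y)` is preconnected: `incl (φ⁻¹(y)) = Z ∩ β⁻¹(b y)` (`b` injective), and the latter is
preconnected by `isPreconnected_frontier_inter_preimage_singleton`, whose inputs are the
homeomorphism `V ≅ (range b)ᶜ` (`stub_pinch_pieceHomeomorph`) and the local connectedness of the
complement of the codimension-`2` surface `range b`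
(`exists_mem_nhds_subset_isPreconnected_inter_compl_range`). [folklore] -/
theorem stub_foldGysin_fibres :
    ∀ (M : Type) [TopologicalSpace M] [T2Space M] [SecondCountableTopology M] [CompactSpace M]
      [ChartedSpace (EuclideanSpace ℝ (Fin 4)) M] [IsManifold (𝓡 4) ∞ M]
      (N : Type) [TopologicalSpace N] [T2Space N] [SecondCountableTopology N]
      [ChartedSpace (EuclideanSpace ℝ (Fin 4)) N] [IsManifold (𝓡 4) ∞ N]
      (S : Type) [TopologicalSpace S] [CompactSpace S] [ChartedSpace (EuclideanSpace ℝ (Fin 2)) S]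
      [IsManifold (𝓡 2) ∞ S]
      (V : Opens M) (b : S → N) (β : M → N) (f : M → ℝ) (h : IsRegularLevel (𝓡 (3 + 1)) f 0)
      (φ : RegularLevel h → S),
      Manifold.IsSmoothEmbedding (𝓡 2) (𝓡 4) ∞ b →
      (∃ U : Set M, IsOpen U ∧ closure (V : Set M) ⊆ U ∧ ContMDiffOn (𝓡 4) (𝓡 4) ∞ β U) →
      Set.InjOn β (V : Set M) → β '' (V : Set M) = (Set.range b)ᶜ →
      (∀ x ∈ (V : Set M), Function.Bijective (mfderiv (𝓡 4) (𝓡 4) β x)) →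
      β '' frontier (V : Set M) ⊆ Set.range b →
      frontier (V : Set M) = f ⁻¹' {0} → (∀ p, b (φ p) = β (RegularLevel.incl h p)) →
      ∀ y, IsPreconnected (φ ⁻¹' {y}) := by
  intro M _ _ _ _ _ _ N _ _ _ _ _ S _ _ _ _ V b β f h φ hb hβU hinj hβV hbij hβfr hfr hφ y
  obtain ⟨U, hUo, hVU, hβ⟩ := hβU
  obtain ⟨e, he⟩ := stub_pinch_pieceHomeomorph M N V (Set.range b) β
    (hβ.mono (subset_closure.trans hVU)) hinj hβV hbij
  have hloc : ∀ D ∈ 𝓝 (b y), ∃ D' ∈ 𝓝 (b y), D' ⊆ D ∧ IsPreconnected (D' ∩ (Set.range b)ᶜ) :=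
    fun D hD => exists_mem_nhds_subset_isPreconnected_inter_compl_range (le_refl (2 + 2))
      hb.contMDiff (b y) hD
  have hK : IsPreconnected (frontier (V : Set M) ∩ β ⁻¹' {b y}) :=
    isPreconnected_frontier_inter_preimage_singleton hUo hVU hβ.continuousOn hβV hβfr e he hloc
  have himg : RegularLevel.incl h '' (φ ⁻¹' {y}) = frontier (V : Set M) ∩ β ⁻¹' {b y} := by
    ext x
    constructor
    · rintro ⟨p, hp, rfl⟩
      refine ⟨?_, ?_⟩
      · rw [hfr]
        exact p.2
      · show β (RegularLevel.incl h p) = b y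
        rw [← hφ p, show φ p = y from hp]
    · rintro ⟨hxfr, hxy⟩
      have hx0 : x ∈ f ⁻¹' {0} := hfr ▸ hxfr
      refine ⟨⟨x, hx0⟩, ?_, rfl⟩
      show φ ⟨x, hx0⟩ = y
      exact hb.isEmbedding.injective (by rw [hφ]; exact hxy)
  rw [← (RegularLevel.isEmbedding_incl h).isInducing.isPreconnected_image, himg]
  exact hK

end Summit.SmoothPoincare4.SmoothPoincare4.Theorems.OrigamiRung.PairRigidityEndgame

end
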